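import Summits.Ventures.PackingBounds.SphericalCodes.GhostMaster
import Literature.Geometry.DiscreteGeometry.ThreePointKernelGeneral

/-!
# `|C| < N` from an exact value-`N` two-atom three-point certificate — Gegenbauer form of the parametric master implication

Framing: lottery ticket; floor = certified bounds/negative ranges. Venture `PackingBounds` (cell
`pub-packcert`, recognition seat, T5.md §8/§9: the SDP-level ghost cells).

`GhostMaster.card_lt_of_tight_twoAtom_certificate` consumes an abstract Bachoc–Vallentin certificate at angle
`s` on `ℝᵐ` whose two-point part is written `A' + a₁·u + a₂·(m u² − 1)`.  The exact kernel checker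
`ThreePointCert.CheckExact` (soundness `ThreePointCert.SoundExactChecks`) delivers the two-point part as a
nonnegative Gegenbauer combination `A(u) = Σ_{k ≤ deg} a_k C_k^{((m−2)/2)}(u)` with `B = 0`.  Since
`C_1^{(α)}(u) = 2αu = (m − 2)u` and `C_2^{(α)}(u) = 2α(α+1)u² − α = α(m u² − 1)` for `α = (m − 2)/2`, a
Gegenbauer-form certificate with `a_1, a_2 > 0`, value exactly `N` and slack zero set `⊆ {s, b}` satisfies the
master implication's hypotheses with `A' = Σ_{k ∉ {1,2}} a_k C_k^{(α)}`, `a₁ = (m−2)a_1`, `a₂ = α a_2`, `b = 0`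
(`card_lt_of_exact_twoAtom_certificate`).  This is the cell-independent version of
`TenTenthExact.card_le_26_of_exact27_certificate`.
-/

noncomputable section

open Finset
open scoped RealInnerProductSpace BigOperators

namespace Summit.Ventures.PackingBounds.SphericalCodes

open Literature.Geometry.DiscreteGeometry Literature.Geometry.DiscreteGeometry.BachocVallentin
open Literature.Analysis.SpecialFunctions

/-- `C_2^{(a)}(s) = 2a(a+1)s² − a`. -/
theorem gegenbauerSum_two (a s : ℝ) : gegenbauerSum a 2 s = 2 * a * (a + 1) * s ^ 2 - a := by
  simp only [gegenbauerSum, gegenbauerCoeff]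
  norm_num [Finset.sum_range_succ, Finset.prod_range_succ, Nat.factorial]
  ring

/-- **`|C| < N` from an exact value-`N` certificate in Gegenbauer form (`B = 0`) with a two-atom slack.**
On `ℝᵐ`, `m ≥ 3`: let `A(u) = Σ_{k ≤ deg} a_k C_k^{((m−2)/2)}(u)` with all `a_k ≥ 0` and `a_1, a_2 > 0`, and let
`F` be symmetric with nonnegative three-point sums over every finite family of unit vectors.  If
`A(u) + 3F(u,u,1) ≤ −1` on `[−1, s]` with equality only for `u ∈ {s, b}`, `F ≤ 0` on the admissible part of
`[−1, s]³`, `1 + A(1) + F(1,1,1) = N`, `1 + (N−1)b ≠ 0`, and the forced exclusive-neighbour count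
`(N/m·(2−2s) − 2(1−s)²)/(2(s−b)²)` is not a natural number, then every finite set of unit vectors of `ℝᵐ` with
pairwise inner products `≤ s` has fewer than `N` elements. -/
theorem card_lt_of_exact_twoAtom_certificate {m : ℕ} (hm : 3 ≤ m) (s b : ℝ) (hsb : s ≠ b) (N : ℕ)
    (hN : 1 ≤ N) (deg : ℕ) (hdeg : 2 ≤ deg) (a : ℕ → ℝ) (ha : ∀ k, 0 ≤ a k) (ha1 : 0 < a 1) (ha2 : 0 < a 2)
    (A : ℝ → ℝ) (hA : ∀ t, A t = ∑ k ∈ range (deg + 1), a k * gegenbauerSum (((m : ℝ) - 2) / 2) k t)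
    (F : ℝ → ℝ → ℝ → ℝ)
    (hF : ∀ D : Finset (EuclideanSpace ℝ (Fin m)), (∀ x ∈ D, ‖x‖ = 1) → 0 ≤ tripleSum D F)
    (hF12 : ∀ u v t, F u v t = F v u t) (hF23 : ∀ u v t, F u v t = F u t v)
    (h1 : ∀ u : ℝ, -1 ≤ u → u ≤ s → A u + 3 * F u u 1 ≤ -1)
    (h2 : ∀ u v t : ℝ, -1 ≤ u → u ≤ s → -1 ≤ v → v ≤ s → -1 ≤ t → t ≤ s →
      0 ≤ 1 + 2 * u * v * t - u ^ 2 - v ^ 2 - t ^ 2 → F u v t ≤ 0)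
    (hval : 1 + A 1 + F 1 1 1 = (N : ℝ))
    (hzero : ∀ u : ℝ, -1 ≤ u → u ≤ s → A u + 3 * F u u 1 = -1 → u = s ∨ u = b)
    (hNb : 1 + ((N : ℝ) - 1) * b ≠ 0)
    (hq : ∀ q : ℕ, (s - b) ^ 2 * (2 * (q : ℝ)) ≠ (N : ℝ) / m * (2 - 2 * s) - 2 * (1 - s) ^ 2)
    (C : Finset (EuclideanSpace ℝ (Fin m))) (hC : ∀ x ∈ C, ‖x‖ = 1)
    (hcode : ∀ x ∈ C, ∀ y ∈ C, x ≠ y → inner ℝ x y ≤ s) : C.card < N := by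
  classical
  set α : ℝ := ((m : ℝ) - 2) / 2 with hα
  have hm0 : 0 < m := by omega
  have hmr : (3 : ℝ) ≤ m := by exact_mod_cast hm
  have hαpos : 0 < α := by rw [hα]; linarith
  -- the two-point part without its degree-1 and degree-2 terms
  let a' : ℕ → ℝ := fun k => if k = 1 then 0 else if k = 2 then 0 else a k
  let A' : ℝ → ℝ := fun t => ∑ k ∈ range (deg + 1), a' k * gegenbauerSum α k t
  have ha' : ∀ k, 0 ≤ a' k := by
    intro k
    by_cases hk1 : k = 1
    · simp [a', hk1]
    · by_cases hk2 : k = 2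
      · simp [a', hk2]
      · simp only [a', hk1, hk2, if_false]; exact ha k
  have hA'nn : ∀ D : Finset (EuclideanSpace ℝ (Fin m)), (∀ x ∈ D, ‖x‖ = 1) → 0 ≤ pairSum D A' :=
    fun D hD => pairSum_gegenbauer_comb_nonneg hm deg a' ha' D hD
  -- the decomposition `A u = A' u + ((m−2) a_1) u + (α a_2)(m u² − 1)`
  have h1mem : 1 ∈ range (deg + 1) := by simp; omega
  have h2mem : 2 ∈ range (deg + 1) := by simp; omega
  have hG1 : ∀ u : ℝ, gegenbauerSum α 1 u = ((m : ℝ) - 2) * u := by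
    intro u; rw [gegenbauerSum_one, hα]; ring
  have hG2 : ∀ u : ℝ, gegenbauerSum α 2 u = α * ((m : ℝ) * u ^ 2 - 1) := by
    intro u; rw [gegenbauerSum_two, hα]; ring
  have hsplit : ∀ u : ℝ, A u = A' u + (((m : ℝ) - 2) * a 1) * u + (α * a 2) * ((m : ℝ) * u ^ 2 - 1) := by
    intro u
    have hpt : ∀ k ∈ range (deg + 1), a k * gegenbauerSum α k u
        = a' k * gegenbauerSum α k u + ((if 1 = k then a k * gegenbauerSum α k u else 0)
          + (if 2 = k then a k * gegenbauerSum α k u else 0)) := by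
      intro k _
      by_cases hk1 : k = 1
      · subst hk1; simp [a']
      · by_cases hk2 : k = 2
        · subst hk2; simp [a']
        · have e1 : ¬ (1 = k) := fun h => hk1 h.symm
          have e2 : ¬ (2 = k) := fun h => hk2 h.symm
          simp [a', hk1, hk2, e1, e2]
    have hA0 : A u = ∑ k ∈ range (deg + 1), a k * gegenbauerSum α k u := by rw [hA u]
    rw [hA0, Finset.sum_congr rfl hpt, Finset.sum_add_distrib, Finset.sum_add_distrib,
      Finset.sum_ite_eq, Finset.sum_ite_eq, if_pos h1mem, if_pos h2mem, hG1, hG2]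
    ring
  have ha₁ : 0 < ((m : ℝ) - 2) * a 1 := mul_pos (by linarith) ha1
  have ha₂ : 0 < α * a 2 := mul_pos hαpos ha2
  -- feed the master implication with `b₁₁ = b₁₂ = b₂₂ = 0`
  refine card_lt_of_tight_twoAtom_certificate hm0 s b hsb N hN A' (((m : ℝ) - 2) * a 1) (α * a 2) ha₁ ha₂
    F 0 0 0 hA'nn hF hF12 hF23 (fun l => by norm_num) ?_ ?_ ?_ ?_ hNb hq C hC hcode
  · intro u hu hu'
    have h := h1 u hu hu'
    rw [hsplit u] at h
    linarith
  · intro u v t hu hu' hv hv' ht ht' hp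
    have h := h2 u v t hu hu' hv hv' ht ht' hp
    simpa using h
  · have h := hval
    rw [hsplit 1] at h
    linarith
  · intro u hu hu' heq
    refine hzero u hu hu' ?_
    rw [hsplit u]
    linarith

end Summit.Ventures.PackingBounds.SphericalCodes

end
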